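import Mathlib.AlgebraicGeometry.IdealSheaf.Functorial
import Mathlib.AlgebraicGeometry.Stalk
import Literature.AlgebraicGeometry.Resolution.IdealSheafLemmas
import HarnessLib

/-!
# Crux `AffineToGlobal` (stmt-ResolutionOfSingularities-15961), line `birth`, stub
# `stub_idealExtension`: ideal sheaves on `Spec 𝒪_{X,x}` are extended from an affine neighbourhood

Route `ResolutionOfSingularities/SectionAscent`, crux `AffineToGlobal`, line `birth`; support
file (`--supports stmt-ResolutionOfSingularities-15961`) landing the registered stub
`stub_idealExtension` of the lead's skeleton `Cruxes/AffineToGlobal/Lines/birth.lean` with exactly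
its registered signature.

**Statement.** For an affine open `U ∋ x` of a scheme `X`, every non-zero ideal sheaf `I` on
`Spec 𝒪_{X,x}` is the pull-back along `Spec (Γ(X, U) ⟶ 𝒪_{X,x})` (the germ map) of a non-zero
ideal sheaf `J₀` on `Spec Γ(X, U)`.

**Proof** (the affine special case of Temkin 2008, Lemma 2.1.1 "ideals on the pro-open
subscheme `Spec 𝒪_{X,x}` are extended": ideals of a localization are extended from their
contractions). The stalk `𝒪_{X,x}` is the localization of `Γ(X, U)` at the prime of `x` along the
germ map (Mathlib `IsAffineOpen.isLocalization_stalk`). On the affine scheme `Spec 𝒪_{X,x}` the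
ideal sheaf `I` is the ideal sheaf of its ideal of global sections
(`IdealSheafData.equivOfIsAffine`), which read in `𝒪_{X,x}` through `ΓSpecIso` is an ideal `I₂`;
its contraction `𝔞 ⊆ Γ(X, U)` satisfies `𝔞 · 𝒪_{X,x} = I₂` (`IsLocalization.map_under`), so the
ideal sheaf `J₀` of `𝔞` on `Spec Γ(X, U)` pulls back to `I` (`comap_ofIdealTop_SpecMap` of
`Literature/AlgebraicGeometry/Resolution/IdealSheafLemmas.lean`), and `J₀ ≠ ⊥` because its
pull-back `I` is non-zero (`IdealSheafData.comap_bot`).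

No new definitions; no named facts are used. Source: M. Temkin, *Desingularization of
quasi-excellent schemes in characteristic zero*, Adv. Math. 219 (2008) 488–522, §2.1,
Lemma 2.1.1 (p. 6) [Temkin2008].
-/

noncomputable section

set_option linter.dupNamespace false -- mandated namespace of this single-conjunct summit

open CategoryTheory CategoryTheory.Limits AlgebraicGeometry

namespace Summit.ResolutionOfSingularities.ResolutionOfSingularities.Theorems.AffineToGlobal.IdealExtension

/-- **Ideal sheaves on the spectrum of a localization are extended.** If `φ : R ⟶ S` presents
`S` as a localization of `R` at a submonoid `M`, then every ideal sheaf `I` on `Spec S` is the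
pull-back along `Spec φ` of the ideal sheaf on `Spec R` of the contraction `φ⁻¹(I(⊤))` of its
ideal of global sections (read in `S` through `ΓSpecIso`): every ideal of a localization is the
extension of its contraction (`IsLocalization.map_under`), and on affine schemes ideal sheaves
are ideals of global sections (`IdealSheafData.equivOfIsAffine`). [folklore] -/
theorem comap_ofIdealTop_contraction {R S : CommRingCat.{0}} (φ : R ⟶ S) (M : Submonoid R)
    (hloc : letI := φ.hom.toAlgebra; IsLocalization M S) (I : (Spec S).IdealSheafData) :
    (Scheme.IdealSheafData.ofIdealTop
        ((((I.ideal ⟨⊤, isAffineOpen_top _⟩).comap (Scheme.ΓSpecIso S).inv.hom).comap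
          φ.hom).map (Scheme.ΓSpecIso R).inv.hom)).comap (Spec.map φ) = I := by
  letI := φ.hom.toAlgebra
  -- the ideal of global sections of `I`, read in `S`, and its contraction to `R`
  set I₂ : Ideal S := (I.ideal ⟨⊤, isAffineOpen_top _⟩).comap (Scheme.ΓSpecIso S).inv.hom
  -- pulling back the ideal sheaf of an ideal `𝔞 ⊆ R` along `Spec φ` gives that of `φ(𝔞) S`
  have h1 : (Scheme.IdealSheafData.ofIdealTop ((I₂.comap φ.hom).map
      (Scheme.ΓSpecIso R).inv.hom)).comap (Spec.map φ) = Scheme.IdealSheafData.ofIdealTop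
        (((I₂.comap φ.hom).map φ.hom).map (Scheme.ΓSpecIso S).inv.hom) :=
    Literature.AlgebraicGeometry.Resolution.comap_ofIdealTop_SpecMap φ.hom (I₂.comap φ.hom)
  -- ideals of the localization `S` are extended from their contractions
  have h2 : (I₂.comap φ.hom).map φ.hom = I₂ := IsLocalization.map_under M S I₂
  -- back through `ΓSpecIso S` (an isomorphism, in particular surjective)
  have h3 : I₂.map (Scheme.ΓSpecIso S).inv.hom = I.ideal ⟨⊤, isAffineOpen_top _⟩ :=
    Ideal.map_comap_of_surjective _
      (Scheme.ΓSpecIso S).commRingCatIsoToRingEquiv.symm.surjective _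
  rw [h1, h2, h3]
  exact Scheme.IdealSheafData.equivOfIsAffine.symm_apply_apply I

/-- **STUB `stub_idealExtension` of crux `AffineToGlobal` (stmt-ResolutionOfSingularities-15961),
line `birth`: ideal sheaves on `Spec 𝒪_{X,x}` are extended from an affine neighbourhood.** For
an affine open `U ∋ x` of a scheme `X`, every non-zero ideal sheaf `I` on `Spec 𝒪_{X,x}` is the
pull-back along `Spec(Γ(X, U) → 𝒪_{X,x})` of a non-zero ideal sheaf `J₀` on `Spec Γ(X, U)`.
Proof: `𝒪_{X,x}` is the localization of `Γ(X, U)` at the prime of `x`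
(`IsAffineOpen.isLocalization_stalk`), so `I` is the pull-back of the ideal sheaf `J₀` of the
contraction of its ideal of global sections (`comap_ofIdealTop_contraction`); and `J₀ ≠ ⊥` since
its pull-back `I` is non-zero (`IdealSheafData.comap_bot`). [cite: Temkin2008, Lemma 2.1.1] -/
theorem stub_idealExtension (X : Scheme.{0}) (U : X.Opens) (hU : IsAffineOpen U) (x : X)
    (hx : x ∈ U) (I : (Spec (X.presheaf.stalk x)).IdealSheafData) (hI : I ≠ ⊥) :
    ∃ J₀ : (Spec Γ(X, U)).IdealSheafData, J₀ ≠ ⊥ ∧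
      J₀.comap (Spec.map (X.presheaf.germ U x hx)) = I := by
  -- `𝒪_{X,x}` is the localization of `Γ(X, U)` at the prime of `x`, along the germ map
  letI : Algebra Γ(X, U) (X.presheaf.stalk x) := (X.presheaf.germ U x hx).hom.toAlgebra
  have hloc : IsLocalization.AtPrime (X.presheaf.stalk x) (hU.primeIdealOf ⟨x, hx⟩).asIdeal :=
    hU.isLocalization_stalk ⟨x, hx⟩
  have h := comap_ofIdealTop_contraction (X.presheaf.germ U x hx)
    (hU.primeIdealOf ⟨x, hx⟩).asIdeal.primeCompl hloc I
  refine ⟨_, ?_, h⟩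
  intro h0
  rw [h0, Scheme.IdealSheafData.comap_bot] at h
  exact hI h.symm

end Summit.ResolutionOfSingularities.ResolutionOfSingularities.Theorems.AffineToGlobal.IdealExtension

end
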